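import Literature.NumberTheory.Automorphic.Zelevinsky1980.RankTwoInducedEndomorphismsIrregular
import Literature.NumberTheory.Automorphic.UnitaryInductionCompleteReducibility
import Literature.NumberTheory.Automorphic.ParabolicGLExactProofs
import Literature.NumberTheory.Automorphic.ParabolicInductionProofs
import HarnessLib

/-!
# `χ × χ` is irreducible on `GL₂(F)` for a unitary character `χ` (the irregular rank-two case)

Topic `NumberTheory/Automorphic/Zelevinsky1980`; theorems only (no definition, no named fact). Let `F` be
a non-archimedean local field and `χ : Fˣ → ℂˣ` a UNITARY CONTINUOUS character. The case `N = 2`,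
`ν₀ = χ′ = χ` of the named fact `Zelevinsky1980.parabolicIndGL_detChar_unitary_isIrreducible`
([Zelevinsky1980, Thm. 4.2 (2)⇒(1)] for `⟨Δ₁⟩ = χ` on `G₁`, `⟨Δ₂⟩ = χ`; file
`ParabolicIndGLDetCharIrreducible`):

* `coe_det_leviProjection_lastBlockLabel_two_false` / `_true` — for `N = 2` both Levi blocks of
  `Q_{1,1}` are `1 × 1`: `det(proj(p)_false) = p₀₀`, `det(proj(p)_true) = p₁₁`;
* **`parabolicIndGL_two_detChar_self_isIrreducible`** — the normalised induced representation
  `parabolicIndGL F (lastBlockLabel 2) ((trivial).twist (maxParabolicLeviChar F 2 χ χ))` of `GL₂(F)`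
  (the fact's binders with `N := 2`, `ν₀ = χ′ := χ`) is IRREDUCIBLE.

Proof: the inducing datum `σ' = (χ ⊗ χ) δ_B^{1/2}` of `B = Q_{1,1}` is smooth
(`Representation.IsSmooth.twist_comp_leviProjection`), trivial on `U_c`
(`rootDeltaChar_eq_one_of_mem_unipotentRadicalP`), and its two torus characters agree on units —
`σ'(diag(u, 1)) = χ(u) = σ'(diag(1, u))` for `|u| = 1`, since `δ_B` is trivial on the compact subgroup
`B ∩ GL₂(𝒪)` (`modularCharacter_eq_one_of_mem_comap_conj`); so every intertwining operator of
`I = Ind_B^{GL₂} σ'` is a scalar (`exists_intertwiningMap_eq_smul_of_apply_diag_eq`, the irregular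
rank-two computation of `RankTwoInducedEndomorphismsIrregular` — here the two exponents of the Jacquet
module COINCIDE, `χ(ϖ) q^{1/2}` twice, and exponent separation gives nothing). Every subrepresentation
of `I` has an invariant complement (`isSemisimpleRepresentation_parabolicIndGL_detChar`, unitarity of
`χ`, `UnitaryInductionCompleteReducibility`) and `I ≠ 0` (a standard section of the open cell), hence
`I` is irreducible (`isIrreducible_of_forall_intertwiningMap_of_exists_isCompl`).

The other cases of the fact — `N ≥ 3`, and `N = 2` with `ν₀ ≠ χ′` (exponent separation,
`UnitaryCharacterInductionRegular`), `N ≤ 1` (`CharacterInductionDegenerate`) — and the assembled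
`_holds` theorem are in the sibling files of this directory (cell `hodgecm-mathlib`, row IV-3 (b)).

## References

* A. V. Zelevinsky, *Induced representations of reductive `p`-adic groups II*, Ann. Sci. ÉNS 13
  (1980), §1.1, §3.2 Example, Thm. 4.2. [Zelevinsky1980]
* I. N. Bernstein, A. V. Zelevinsky, *Induced representations of reductive `p`-adic groups I*,
  Ann. Sci. ÉNS 10 (1977), Thm. 5.2, §7.1. [BernsteinZelevinskyASENS1977]
* D. Bump, *Automorphic Forms and Representations* (1997), Thm. 4.5.1–4.5.3 (irreducibility of the
  `GL₂` principal series with `χ₁ = χ₂`). [Bump1997]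
-/

noncomputable section

open Matrix Literature.LinearAlgebra.Matrix.DiagonalTorus

namespace Literature.NumberTheory.Automorphic.Zelevinsky1980

open ValuativeRel Valued

variable (F : Type*) [Field F]

/-- For `N = 2` both blocks of `Q_{1,1}` are `1 × 1`: `det(proj(p)_false) = p₀₀`.
[cite: Zelevinsky1980, §1.1, p. 170] -/
theorem coe_det_leviProjection_lastBlockLabel_two_false
    (p : standardParabolicGL F (lastBlockLabel 2)) :
    ((Matrix.GeneralLinearGroup.det (leviProjection F (lastBlockLabel 2) p false) : Fˣ) : F) =
      ((p : GL (Fin 2) F) : Matrix (Fin 2) (Fin 2) F) 0 0 := by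
  haveI : Subsingleton {i : Fin 2 // lastBlockLabel 2 i = false} := ⟨by
    rintro ⟨i, hi⟩ ⟨j, hj⟩
    have key : ∀ k : Fin 2, lastBlockLabel 2 k = false → k = 0 := by
      intro k hk; fin_cases k
      · rfl
      · simp [lastBlockLabel] at hk
    exact Subtype.ext ((key i hi).trans (key j hj).symm)⟩
  rw [Matrix.GeneralLinearGroup.val_det_apply,
    Matrix.det_eq_elem_of_subsingleton _ ⟨0, by simp [lastBlockLabel]⟩, leviProjection_apply_coe]

/-- For `N = 2`: `det(proj(p)_true) = p₁₁`. [cite: Zelevinsky1980, §1.1, p. 170] -/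
theorem coe_det_leviProjection_lastBlockLabel_two_true
    (p : standardParabolicGL F (lastBlockLabel 2)) :
    ((Matrix.GeneralLinearGroup.det (leviProjection F (lastBlockLabel 2) p true) : Fˣ) : F) =
      ((p : GL (Fin 2) F) : Matrix (Fin 2) (Fin 2) F) 1 1 := by
  haveI : Subsingleton {i : Fin 2 // lastBlockLabel 2 i = true} := ⟨by
    rintro ⟨i, hi⟩ ⟨j, hj⟩
    have key : ∀ k : Fin 2, lastBlockLabel 2 k = true → k = 1 := by
      intro k hk; fin_cases k
      · simp [lastBlockLabel] at hk
      · rfl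
    exact Subtype.ext ((key i hi).trans (key j hj).symm)⟩
  rw [Matrix.GeneralLinearGroup.val_det_apply,
    Matrix.det_eq_elem_of_subsingleton _ ⟨1, by simp [lastBlockLabel]⟩, leviProjection_apply_coe]

variable [ValuativeRel F] [TopologicalSpace F] [IsNonarchimedeanLocalField F]

/-- **`χ × χ` is irreducible on `GL₂(F)` for a unitary continuous character `χ`** — the IRREGULAR
case `N = 2`, `ν₀ = χ′ = χ` of the named fact `parabolicIndGL_detChar_unitary_isIrreducible`
([Zelevinsky1980, Thm. 4.2]): the normalised induced representation
`parabolicIndGL F (lastBlockLabel 2) ((trivial).twist (maxParabolicLeviChar F 2 χ χ))` is irreducible.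
Proof: its endomorphisms are scalars (`exists_intertwiningMap_eq_smul_of_apply_diag_eq`: the inducing
datum `σ' = (χ ⊗ χ) δ_B^{1/2}` is smooth, trivial on `U_c`, and `σ'(diag(u,1)) = χ(u) = σ'(diag(1,u))` for
`|u| = 1`, `δ_B` being trivial on `B ∩ GL₂(𝒪)`), every subrepresentation has an invariant complement
(`isSemisimpleRepresentation_parabolicIndGL_detChar`, unitarity), and the space is non-zero (a standard
section); hence irreducible (`isIrreducible_of_forall_intertwiningMap_of_exists_isCompl`).
[cite: Zelevinsky1980, Thm. 4.2 (2)⇒(1), p. 184 (with §3.2 Example, p. 181)] -/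
theorem parabolicIndGL_two_detChar_self_isIrreducible
    [LocallyCompactSpace (standardParabolicGL F (lastBlockLabel 2))]
    (χ : Fˣ →* ℂˣ) (hχu : ∀ x, ‖((χ x : ℂˣ) : ℂ)‖ = 1) (hχc : Continuous fun x => ((χ x : ℂˣ) : ℂ)) :
    (Representation.parabolicIndGL F (lastBlockLabel 2)
      ((Representation.trivial ℂ (Π a : Bool, GL {i : Fin 2 // lastBlockLabel 2 i = a} F) ℂ).twist
        (maxParabolicLeviChar F 2 χ χ))).IsIrreducible := by
  classical
  haveI : T2Space F := (GaloisRepresentations.IsNonarchimedeanLocalField.isLocalField F).toT2Space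
  have hc : Monotone (lastBlockLabel 2) := monotone_lastBlockLabel 2
  set σ : Representation ℂ (Π a : Bool, GL {i : Fin 2 // lastBlockLabel 2 i = a} F) ℂ :=
    (Representation.trivial ℂ (Π a : Bool, GL {i : Fin 2 // lastBlockLabel 2 i = a} F) ℂ).twist
      (maxParabolicLeviChar F 2 χ χ) with hσdef
  set σ' : Representation ℂ ↥(standardParabolicGL F (lastBlockLabel 2)) ℂ :=
    Representation.twist (σ.comp (leviProjection F (lastBlockLabel 2)))
      (rootDeltaChar (standardParabolicGL F (lastBlockLabel 2))) with hσ'def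
  -- the inducing datum `σ' = (χ ⊗ χ) δ^{1/2}`: its values
  have hσ'val : ∀ (p : ↥(standardParabolicGL F (lastBlockLabel 2))) (z : ℂ),
      σ' p z = ((rootDeltaChar (standardParabolicGL F (lastBlockLabel 2)) p : ℂˣ) : ℂ) *
        ((((χ (Matrix.GeneralLinearGroup.det (leviProjection F (lastBlockLabel 2) p false)) : ℂˣ) : ℂ) *
          ((χ (Matrix.GeneralLinearGroup.det (leviProjection F (lastBlockLabel 2) p true)) : ℂˣ) : ℂ)) * z) := by
    intro p z
    rw [hσ'def, Representation.twist_apply, MonoidHom.comp_apply, hσdef, Representation.twist_apply,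
      Representation.trivial_apply, maxParabolicLeviChar_apply, Units.val_mul, smul_eq_mul, smul_eq_mul]
  -- smooth
  have hχo := Liu2021.SplitPlace.isOpen_ker_of_continuous χ hχc
  have hσs : σ.IsSmooth :=
    (Liu2021.SplitPlace.isAdmissible_trivial_twist _
      (Liu2021.SplitPlace.isOpen_ker_maxParabolicLeviChar 2 χ χ hχo hχo)).isSmooth
  have hσ' : σ'.IsSmooth := Representation.IsSmooth.twist_comp_leviProjection F (lastBlockLabel 2) hσs
  -- trivial on `U_c`
  have hU : ∀ u : ↥(standardParabolicGL F (lastBlockLabel 2)),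
      u ∈ unipotentRadicalP F (lastBlockLabel 2) → σ' u = 1 := by
    intro u hu
    apply LinearMap.ext
    intro z
    have hlev : leviProjection F (lastBlockLabel 2) u = 1 := (MonoidHom.mem_ker).1 hu
    rw [Module.End.one_apply, hσ'def, Representation.twist_apply, MonoidHom.comp_apply, hlev, map_one,
      Module.End.one_apply, rootDeltaChar_eq_one_of_mem_unipotentRadicalP F (lastBlockLabel 2) hu,
      Units.val_one, one_smul]
  -- the two torus characters agree on units: `σ'(diag(u,1)) = χ(u) = σ'(diag(1,u))`
  have hδ1 : ∀ (p : ↥(standardParabolicGL F (lastBlockLabel 2))), (p : GL (Fin 2) F) ∈ glInt 2 F →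
      ((rootDeltaChar (standardParabolicGL F (lastBlockLabel 2)) p : ℂˣ) : ℂ) = 1 := by
    intro p hp
    have hmod : MeasureTheory.Measure.modularCharacter p = 1 :=
      modularCharacter_eq_one_of_mem_comap_conj (K := glInt 2 F) (s := 1)
        (isClosed_standardParabolicGL F (lastBlockLabel 2)) (isOpen_glInt 2 F) (isCompact_glInt 2 F)
        (by rw [Subgroup.mem_comap, map_one]; exact hp)
    rw [rootDeltaChar_apply, hmod, NNReal.sqrt_one, NNReal.coe_one, Complex.ofReal_one]
  have hdiag_glInt : ∀ (v : Fin 2 → Fˣ), (∀ i, valuation F (v i : F) = 1) →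
      diagGL (Fin 2) v ∈ glInt 2 F := by
    intro v hv
    refine mem_glInt_of_isIntegralMatrix (fun i j => ?_) ?_
    · rw [val_diagGL, Matrix.diagonal_apply]
      split_ifs with h
      · exact (Valuation.mem_integer_iff _ _).2 (hv i).le
      · exact Subring.zero_mem _
    · rw [val_diagGL, Matrix.det_diagonal, map_prod, Finset.prod_eq_one fun i _ => hv i]
  have hH : ∀ u : Fˣ, valuation F (u : F) = 1 →
      σ' ⟨diagGL (Fin 2) (Function.update 1 0 u), diagGL_mem_standardParabolicGL _ _⟩ 1 =
        σ' ⟨diagGL (Fin 2) (Function.update 1 (Fin.last 1) u), diagGL_mem_standardParabolicGL _ _⟩ 1 := by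
    intro u hu
    have h1 : ∀ i, valuation F ((Function.update (1 : Fin 2 → Fˣ) 0 u i : Fˣ) : F) = 1 := by
      intro i; fin_cases i <;> simp [hu]
    have h2 : ∀ i, valuation F ((Function.update (1 : Fin 2 → Fˣ) (Fin.last 1) u i : Fˣ) : F) = 1 := by
      intro i; fin_cases i <;> simp [hu, Fin.last]
    have hdet : ∀ (v : Fin 2 → Fˣ) (a : Bool),
        Matrix.GeneralLinearGroup.det (leviProjection F (lastBlockLabel 2)
          ⟨diagGL (Fin 2) v, diagGL_mem_standardParabolicGL _ _⟩ a) = if a then v 1 else v 0 := by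
      intro v a
      apply Units.ext
      cases a
      · rw [coe_det_leviProjection_lastBlockLabel_two_false]
        simp [val_diagGL]
      · rw [coe_det_leviProjection_lastBlockLabel_two_true]
        simp [val_diagGL]
    rw [hσ'val, hσ'val, hδ1 _ (hdiag_glInt _ h1), hδ1 _ (hdiag_glInt _ h2), hdet, hdet, hdet, hdet]
    simp [Function.update, Fin.last, mul_comm]
  -- `End = ℂ`
  have hEnd := exists_intertwiningMap_eq_smul_of_apply_diag_eq σ' hσ' hU hH
  -- complete reducibility (unitarity)
  have hss := isSemisimpleRepresentation_parabolicIndGL_detChar F 2 χ χ hχu hχc hχu hχc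
  have hcr : ∀ W : Subrepresentation (Representation.parabolicIndGL F (lastBlockLabel 2) σ),
      ∃ W' : Subrepresentation (Representation.parabolicIndGL F (lastBlockLabel 2) σ),
        IsCompl W.toSubmodule W'.toSubmodule := by
    intro W
    obtain ⟨W', hW'⟩ := exists_isCompl W
    refine ⟨W', ⟨?_, ?_⟩⟩
    · rw [disjoint_iff]
      exact congrArg Subrepresentation.toSubmodule (disjoint_iff.1 hW'.1)
    · rw [codisjoint_iff]
      exact congrArg Subrepresentation.toSubmodule (codisjoint_iff.1 hW'.2)
  -- non-zero: a standard section
  obtain ⟨ϖ, hϖ⟩ := exists_isUniformizingElement (F := F)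
  have hvϖ0 : valuation F ϖ ≠ 0 := (Valuation.ne_zero_iff _).mpr hϖ.ne_zero
  set K : Subgroup ↥(oppositeCellRadical (K := F) (lastBlockLabel 2)) :=
    (congruenceGL 2 (valuation F ϖ)).comap (oppositeCellRadical (K := F) (lastBlockLabel 2)).subtype
    with hKdef
  have hKo : IsOpen (K : Set ↥(oppositeCellRadical (K := F) (lastBlockLabel 2))) :=
    isOpen_comap_congruenceGL hvϖ0
  have hKc : IsCompact (K : Set ↥(oppositeCellRadical (K := F) (lastBlockLabel 2))) :=
    isCompact_comap_congruenceGL _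
  haveI : Nontrivial (Representation.SmoothInd (standardParabolicGL F (lastBlockLabel 2)) σ') := by
    refine ⟨⟨cellSection σ' hc hσ' K hKo hKc 1, 0, fun h => ?_⟩⟩
    have h1 := congrArg (fun f : Representation.SmoothInd (standardParabolicGL F (lastBlockLabel 2)) σ' =>
      f.toFun (1 * permGL Fin.revPerm * 1)) h
    simp only [toFun_cellSection, Representation.SmoothInd.toFun_zero, Pi.zero_apply] at h1
    rw [cellSectionFun_eq_of_mem hc (1 : ℂ) (Subgroup.one_mem _) (Subgroup.one_mem _)
      (by exact K.one_mem)] at h1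
    exact apply_one_ne_zero σ' _ h1
  exact isIrreducible_of_forall_intertwiningMap_of_exists_isCompl _ hEnd hcr

end Literature.NumberTheory.Automorphic.Zelevinsky1980
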